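import Summits.CriticalPhenomena.PercolationContinuityZ3.Theorems.PercNearOneGluingNoHeavyLowerTailQuantitativeHarrisExplicitStrictness
import Summits.CriticalPhenomena.PercolationContinuityZ3.Theorems.PercNearOneGluingNoHeavyLowerTailQuantitativeHarrisTwoCylinderFloor
import Summits.CriticalPhenomena.PercolationContinuityZ3.Theorems.PercNearOneGluingNoHeavyLowerTailQuantitativeS5FloorCompleteFar
import HarnessLib

/-!
# A LOCAL explicit floor for the (S5) margin: cylinder witnesses (`margin ≥ p₀^{N_{<a}}·(p₀(1−p₀))^{|R|+1}·J`, `R ⊇ R₁ ∪ R₂`)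

Support file (`--supports stmt-CriticalPhenomena-4575`), prover seat `prim-rate-mine-2` (lane prim-rate, constants-miner (c), BENCH row
M2-R49 (b); `run/shared/lean/prim/prim-rate/prim-rate-mine-2/PROOFS.md` §P49).  No definitions, no named facts, no sorries; standard axioms.

Rows M2-R47/48 floored the isolated Harris term of the explicit (S5) floor at a relay `a` by a constant exponential in `|E|` (the volume):
`p₀^{|E|}·(p₀(1−p₀))^{|E|}·J` (`CSH.floor_iso_ge_explicit_sharp`).  With the TWO-CYLINDER floor (`QuantHarris.cov_ge_prodPow_cyl_mul_jumps`,
row M2-R49) the constant becomes LOCAL: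

* `CSH.floor_iso_ge_explicit_cyl` — weights `w = 0` off `E`, `p₀ ≤ w ≤ 1 − p₀` on `E`; a pair `e ∈ E` missing `T_{<a}`; CYLINDER witnesses:
  finite sets `R₁, R₂` of pairs of `E` missing `T_{<a}` (and `≠ e`) with patterns `η₁, η₂` such that the `F(V 𝒞_a)`-jump at `e` is `≥ J ≥ 0` on
  every configuration INSIDE `E_{<a} := {pairs of E missing T_{<a}}` (the support of the floor's zeroed measure) agreeing with `η₁` on `R₁`, and `e` is
  pivotal for the floor's event `{o ↔ a ∨ o ↔ T_{>a} ∨ o ↔ v}` on every configuration inside `E_{<a}` agreeing with `η₂` on `R₂` (percolation reading: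
  `R₂` = one open path through `e` + one closed cut-set, both inside `E_{<a}`; quantifying over configurations inside `E_{<a}` only — audit-1-g40's
  precision — is what makes the witnesses as frequent as the atom witnesses of rows M2-R47/48: the proof feeds the two-cylinder floor the
  restrictions `ζ ↦ f(ζ ∩ E_{<a})`, which have the same integrals since a.e. `ζ ⊆ E_{<a}`, `CSH.ae_subset_support`).  Then the `a`-term is
  **`≥ p₀^{N_{<a}} · (p₀(1−p₀))^{|R| + 1} · J`** (`R ⊇ R₁ ∪ R₂` any bound inside the pairs of `E` missing `T_{<a}`, `e ∉ R`), `N_{<a}` = the number of pairs of `E` meeting `T_{<a}` (the zeroed pairs; `∏(1−w) ≥ p₀^{N_{<a}}`);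
* `CSH.s5dMargin_nil_ge_explicit_cyl` — hence **`p₀^{N_{<a}}·(p₀(1−p₀))^{|R|+1}·J ≤ s5dMargin w T r [] o v F`** at a compatible injective rank.
No factor depends on `|E|`: the exponent is (#pairs at the lower relays) + (size of the two witness cylinders) + 1.
[cite: Harris1960, Lemma 4.1 (p. 16)] [cite: KozmaNitzan2024, Conj. 4 (p. 32)] [cite: Talagrand1996, Thm. 1.1 (p. 244)]
-/

noncomputable section

namespace Summit.CriticalPhenomena.PercolationContinuityZ3.Theorems

open MeasureTheory Set Literature.Probability.LatticeModels Literature.Probability.Percolation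
open scoped Classical
open KNPreFKG

namespace CSH

variable {n : ℕ}

/-- **Local isolated Harris term (cylinder witnesses).**  See the module docstring; the `a`-term `∏(1 − w)·Cov` of the explicit floor (general
decoy list `D`) is `≥ p₀^{N_{<a}}·(p₀(1−p₀))^{|R|+1}·J`, `R ⊇ R₁ ∪ R₂`. [cite: Harris1960, Lemma 4.1 (p. 16)] [cite: Talagrand1996, Thm. 1.1 (p. 244)] -/
theorem floor_iso_ge_explicit_cyl (w : Sym2 (Fin n) → unitInterval) (E : Finset (Sym2 (Fin n))) (p₀ : ℝ) (hp0 : 0 < p₀)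
    (hE0 : ∀ f, f ∉ E → (w f : ℝ) = 0) (hE1 : ∀ f ∈ E, p₀ ≤ (w f : ℝ) ∧ (w f : ℝ) ≤ 1 - p₀) (o v : Fin n)
    (T : Finset (Fin n)) (r : Fin n → ℕ) (D : List (Fin n)) (a : Fin n)
    (F : Set (Fin n) → ℝ) (hF : ∀ S S' : Set (Fin n), S ⊆ S' → F S ≤ F S') (hF0 : ∀ S : Set (Fin n), 0 ≤ F S)
    (e : Sym2 (Fin n)) (heE : e ∈ E) (heY : ∀ y ∈ (↑(T.filter (fun b => r b < r a)) : Set (Fin n)), y ∉ e)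
    (R R₁ R₂ : Finset (Sym2 (Fin n)))
    (hR : ∀ g ∈ R, g ∈ E ∧ g ≠ e ∧ ∀ y ∈ (↑(T.filter (fun b => r b < r a)) : Set (Fin n)), y ∉ g)
    (hR₁ : R₁ ⊆ R) (hR₂ : R₂ ⊆ R)
    (η₁ η₂ : Set (Sym2 (Fin n))) (J : ℝ) (hJ : 0 ≤ J)
    (hc₁ : ∀ ω : Set (Sym2 (Fin n)), ω ⊆ ↑(E.filter (fun g => ∀ y ∈ (↑(T.filter (fun b => r b < r a)) : Set (Fin n)), y ∉ g)) →
      (∀ g ∈ R₁, (g ∈ ω ↔ g ∈ η₁)) →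
      J ≤ F {c | c = a ∨ ∃ e' ∈ openEdgeCluster (insert e ω) a, c ∈ e'} - F {c | c = a ∨ ∃ e' ∈ openEdgeCluster (ω \ {e}) a, c ∈ e'})
    (hc₂ : ∀ ω : Set (Sym2 (Fin n)), ω ⊆ ↑(E.filter (fun g => ∀ y ∈ (↑(T.filter (fun b => r b < r a)) : Set (Fin n)), y ∉ g)) →
      (∀ g ∈ R₂, (g ∈ ω ↔ g ∈ η₂)) →
      insert e ω ∈ ((⋃ t ∈ (insert a (T.filter (fun b => r a < r b) ∪ D.toFinset)), openConn o t) ∪ openConn o v :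
          Set (BondConfig (Fin n))) ∧
        ω \ {e} ∉ ((⋃ t ∈ (insert a (T.filter (fun b => r a < r b) ∪ D.toFinset)), openConn o t) ∪ openConn o v :
          Set (BondConfig (Fin n)))) :
    p₀ ^ (E.filter (fun g : Sym2 (Fin n) => ∃ y ∈ (↑(T.filter (fun b => r b < r a)) : Set (Fin n)), y ∈ g)).card *
        (p₀ * (1 - p₀)) ^ (R.card + 1) * J ≤
      (∏ e ∈ Finset.univ.filter (fun e : Sym2 (Fin n) => ∃ y ∈ (↑(T.filter (fun b => r b < r a)) : Set (Fin n)), y ∈ e), (1 - (w e : ℝ))) *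
          ((∫ η in ((⋃ t ∈ (insert a (T.filter (fun b => r a < r b) ∪ (D).toFinset)), openConn o t) ∪ openConn o v),
              F {c | c = a ∨ ∃ e ∈ openEdgeCluster η a, c ∈ e}
              ∂(prodBernoulli fun e => if (∃ y ∈ (↑(T.filter (fun b => r b < r a)) : Set (Fin n)), y ∈ e) then (0 : unitInterval) else w e)) -
            (prodBernoulli fun e => if (∃ y ∈ (↑(T.filter (fun b => r b < r a)) : Set (Fin n)), y ∈ e) then (0 : unitInterval) else w e).real
                ((⋃ t ∈ (insert a (T.filter (fun b => r a < r b) ∪ (D).toFinset)), openConn o t) ∪ openConn o v) *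
              (∫ η, F {c | c = a ∨ ∃ e ∈ openEdgeCluster η a, c ∈ e}
                ∂(prodBernoulli fun e => if (∃ y ∈ (↑(T.filter (fun b => r b < r a)) : Set (Fin n)), y ∈ e) then (0 : unitInterval) else w e))) := by
  have hmeas : ∀ S : Set (BondConfig (Fin n)), MeasurableSet S := fun _ => MeasurableSet.of_discrete
  have hp01 : p₀ ≤ 1 := by linarith [(hE1 e heE).1, (hE1 e heE).2]
  set Y : Set (Fin n) := (↑(T.filter (fun b => r b < r a)) : Set (Fin n)) with hY
  set U : Set (BondConfig (Fin n)) :=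
    (⋃ t ∈ (insert a (T.filter (fun b => r a < r b) ∪ D.toFinset)), openConn o t) ∪ openConn o v with hU
  set qY : Sym2 (Fin n) → unitInterval := fun e => if (∃ y ∈ Y, y ∈ e) then (0 : unitInterval) else w e with hqY
  set EY : Finset (Sym2 (Fin n)) := E.filter (fun f => ∀ y ∈ Y, y ∉ f) with hEY
  set f : BondConfig (Fin n) → ℝ := fun ζ => F {c | c = a ∨ ∃ e ∈ openEdgeCluster ζ a, c ∈ e} with hfdef
  have hUup : ∀ ω ω' : BondConfig (Fin n), ω ⊆ ω' → ω ∈ U → ω' ∈ U := by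
    rintro ω ω' hle (h | h)
    · obtain ⟨t, ht, h⟩ := Set.mem_iUnion₂.1 h
      exact Or.inl (Set.mem_iUnion₂.2 ⟨t, ht, SimpleGraph.Reachable.mono (BHK2006.openGraph_le hle) h⟩)
    · exact Or.inr (SimpleGraph.Reachable.mono (BHK2006.openGraph_le hle) h)
  have hfmono : Monotone f := fun _ _ h => (monotone_clusterFun a F hF) (BHK2006.openEdgeCluster_mono h a)
  have hf0 : ∀ ζ, 0 ≤ f ζ := fun _ => hF0 _
  -- the zeroed weights lie in `[p₀, 1 − p₀]` on `EY`
  have hq1 : ∀ g ∈ EY, p₀ ≤ ((qY g : unitInterval) : ℝ) ∧ ((qY g : unitInterval) : ℝ) ≤ 1 - p₀ := by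
    intro g hg
    obtain ⟨hgE, hgY⟩ := Finset.mem_filter.1 hg
    have hc : ¬ ∃ y ∈ Y, y ∈ g := by
      rintro ⟨y, hy, hyg⟩
      exact hgY y hy hyg
    simp only [hqY]
    rw [if_neg hc]
    exact hE1 g hgE
  have heEY : e ∈ EY := Finset.mem_filter.2 ⟨heE, heY⟩
  have hR' : R ⊆ EY := fun g hg => Finset.mem_filter.2 ⟨(hR g hg).1, (hR g hg).2.2⟩
  have heR : e ∉ R := fun h => (hR e h).2.1 rfl
  -- the zeroed weights vanish off `EY`
  have hq0 : ∀ g, g ∉ (↑EY : Set (Sym2 (Fin n))) → ((qY g : unitInterval) : ℝ) = 0 := by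
    intro g hg
    simp only [hqY]
    by_cases hc : ∃ y ∈ Y, y ∈ g
    · rw [if_pos hc]; rfl
    · rw [if_neg hc]
      apply hE0 g
      intro hgE
      exact hg (Finset.mem_coe.2 (Finset.mem_filter.2 ⟨hgE, fun y hy hyg => hc ⟨y, hy, hyg⟩⟩))
  -- restrict the two functionals to the support `EY` (the cylinder hypotheses only speak about configurations inside `EY`)
  set f' : BondConfig (Fin n) → ℝ := fun ζ => f (ζ ∩ ↑EY) with hf'def
  set u' : BondConfig (Fin n) → ℝ := fun ζ => U.indicator (fun _ => (1 : ℝ)) (ζ ∩ ↑EY) with hu'def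
  have hf'mono : Monotone f' := fun ζ ζ' h => hfmono (Set.inter_subset_inter_left _ h)
  have hu'mono : Monotone u' := fun ζ ζ' h => (QuantHarris.indicator_upset_monotone hUup) (Set.inter_subset_inter_left _ h)
  have hf'0 : ∀ ζ, 0 ≤ f' ζ := fun _ => hF0 _
  have hu'0 : ∀ ζ, 0 ≤ u' ζ := fun ζ => Set.indicator_nonneg (fun _ _ => zero_le_one) _
  have heEYs : e ∈ (↑EY : Set (Sym2 (Fin n))) := Finset.mem_coe.2 heEY
  have hins : ∀ ω : Set (Sym2 (Fin n)), insert e ω ∩ ↑EY = insert e (ω ∩ ↑EY) := fun ω => Set.insert_inter_of_mem heEYs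
  have hdif : ∀ ω : Set (Sym2 (Fin n)), (ω \ {e}) ∩ ↑EY = (ω ∩ ↑EY) \ {e} := fun ω => by
    ext g; simp only [Set.mem_inter_iff, Set.mem_sdiff, Set.mem_singleton_iff]; tauto
  have hc₁' : ∀ ω : Set (Sym2 (Fin n)), (∀ g ∈ R₁, (g ∈ ω ↔ g ∈ η₁)) → J ≤ f' (insert e ω) - f' (ω \ {e}) := by
    intro ω hω
    simp only [hf'def, hfdef, hins, hdif]
    exact hc₁ (ω ∩ ↑EY) Set.inter_subset_right fun g hg =>
      ⟨fun h => (hω g hg).1 h.1, fun h => ⟨(hω g hg).2 h, Finset.mem_coe.2 (hR' (hR₁ hg))⟩⟩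
  have hc₂' : ∀ ω : Set (Sym2 (Fin n)), (∀ g ∈ R₂, (g ∈ ω ↔ g ∈ η₂)) → (1 : ℝ) ≤ u' (insert e ω) - u' (ω \ {e}) := by
    intro ω hω
    have h := hc₂ (ω ∩ ↑EY) Set.inter_subset_right fun g hg =>
      ⟨fun h => (hω g hg).1 h.1, fun h => ⟨(hω g hg).2 h, Finset.mem_coe.2 (hR' (hR₂ hg))⟩⟩
    simp only [hu'def, hins, hdif]
    rw [Set.indicator_of_mem h.1, Set.indicator_of_notMem h.2, sub_zero]
  have hcov0 := QuantHarris.cov_ge_prodPow_cyl_mul_jumps qY EY p₀ hp0.le hq1 f' u' hf'0 hu'0 hf'mono hu'mono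
    e heEY R R₁ R₂ hR' hR₁ hR₂ heR η₁ η₂ J 1 hJ zero_le_one hc₁' hc₂'
  rw [mul_one] at hcov0
  -- a.e. `ω ⊆ EY`, so the restricted functionals have the original integrals
  have hae := ae_subset_support qY (↑EY : Set (Sym2 (Fin n))) hq0
  have hEf : (fun ζ => f' ζ * u' ζ) =ᵐ[prodBernoulli qY] fun ζ => f ζ * U.indicator (fun _ => (1 : ℝ)) ζ := by
    filter_upwards [hae] with ζ hζ
    simp only [hf'def, hu'def, Set.inter_eq_left.2 hζ]
  have hEf1 : f' =ᵐ[prodBernoulli qY] f := by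
    filter_upwards [hae] with ζ hζ
    simp only [hf'def, Set.inter_eq_left.2 hζ]
  have hEu1 : u' =ᵐ[prodBernoulli qY] U.indicator (fun _ => (1 : ℝ)) := by
    filter_upwards [hae] with ζ hζ
    simp only [hu'def, Set.inter_eq_left.2 hζ]
  have hcov : (p₀ * (1 - p₀)) ^ (R.card + 1) * J ≤
      ∫ ζ, f ζ * U.indicator (fun _ => (1 : ℝ)) ζ ∂(prodBernoulli qY) -
        (∫ ζ, f ζ ∂(prodBernoulli qY)) * ∫ ζ, U.indicator (fun _ => (1 : ℝ)) ζ ∂(prodBernoulli qY) := by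
    rw [← integral_congr_ae hEf, ← integral_congr_ae hEf1, ← integral_congr_ae hEu1]
    exact hcov0
  have hprod : (fun ζ => f ζ * U.indicator (fun _ => (1 : ℝ)) ζ) = U.indicator f := by
    funext ζ
    by_cases hζ : ζ ∈ U
    · rw [Set.indicator_of_mem hζ, Set.indicator_of_mem hζ, mul_one]
    · rw [Set.indicator_of_notMem hζ, Set.indicator_of_notMem hζ, mul_zero]
  rw [hprod, integral_indicator (hmeas U), integral_indicator (hmeas U)] at hcov
  simp only [integral_const, smul_eq_mul, mul_one, measureReal_restrict_apply_univ] at hcov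
  -- hcov : (p₀(1-p₀))^(|R₁∪R₂|+1) * J ≤ ∫_U f − (∫ f) * μ(U)
  -- the prefactor `∏ (1 − w) ≥ p₀ ^ N_{<a}`
  have hpref : p₀ ^ (E.filter (fun g : Sym2 (Fin n) => ∃ y ∈ Y, y ∈ g)).card ≤
      ∏ g ∈ Finset.univ.filter (fun g : Sym2 (Fin n) => ∃ y ∈ Y, y ∈ g), (1 - (w g : ℝ)) := by
    have hsplit := Finset.prod_filter_mul_prod_filter_not (Finset.univ.filter (fun g : Sym2 (Fin n) => ∃ y ∈ Y, y ∈ g))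
      (fun g => g ∈ E) (fun g => (1 - (w g : ℝ)))
    rw [← hsplit]
    have hset : (Finset.univ.filter (fun g : Sym2 (Fin n) => ∃ y ∈ Y, y ∈ g)).filter (fun g => g ∈ E)
        = E.filter (fun g : Sym2 (Fin n) => ∃ y ∈ Y, y ∈ g) := by
      ext g
      simp only [Finset.mem_filter, Finset.mem_univ, true_and]
      exact ⟨fun h => ⟨h.2, h.1⟩, fun h => ⟨h.2, h.1⟩⟩
    have h1 : p₀ ^ (E.filter (fun g : Sym2 (Fin n) => ∃ y ∈ Y, y ∈ g)).card ≤
        ∏ g ∈ (Finset.univ.filter (fun g : Sym2 (Fin n) => ∃ y ∈ Y, y ∈ g)).filter (fun g => g ∈ E), (1 - (w g : ℝ)) := by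
      rw [hset]
      calc p₀ ^ (E.filter (fun g : Sym2 (Fin n) => ∃ y ∈ Y, y ∈ g)).card
          = ∏ _g ∈ E.filter (fun g : Sym2 (Fin n) => ∃ y ∈ Y, y ∈ g), p₀ := (Finset.prod_const p₀).symm
        _ ≤ _ := Finset.prod_le_prod (fun _ _ => hp0.le) fun g hg => by linarith [(hE1 g (Finset.mem_filter.1 hg).1).2]
    have h2 : ∏ g ∈ (Finset.univ.filter (fun g : Sym2 (Fin n) => ∃ y ∈ Y, y ∈ g)).filter (fun g => ¬ g ∈ E), (1 - (w g : ℝ)) = 1 :=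
      Finset.prod_eq_one fun g hg => by rw [hE0 g (Finset.mem_filter.1 hg).2, sub_zero]
    rw [h2, mul_one]
    exact h1
  have hpref0 : 0 ≤ p₀ ^ (E.filter (fun g : Sym2 (Fin n) => ∃ y ∈ Y, y ∈ g)).card := pow_nonneg hp0.le _
  have hc0 : 0 ≤ (p₀ * (1 - p₀)) ^ (R.card + 1) * J := mul_nonneg (pow_nonneg (mul_nonneg hp0.le (by linarith)) _) hJ
  have hcov' : (p₀ * (1 - p₀)) ^ (R.card + 1) * J ≤
      (∫ ζ in U, f ζ ∂(prodBernoulli qY)) - (prodBernoulli qY).real U * ∫ ζ, f ζ ∂(prodBernoulli qY) := by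
    rw [mul_comm ((prodBernoulli qY).real U) _]
    exact hcov
  have h := mul_le_mul hpref hcov' hc0 (hpref0.trans hpref)
  have hpow : p₀ ^ (E.filter (fun g : Sym2 (Fin n) => ∃ y ∈ Y, y ∈ g)).card * ((p₀ * (1 - p₀)) ^ (R.card + 1) * J) =
      p₀ ^ (E.filter (fun g : Sym2 (Fin n) => ∃ y ∈ Y, y ∈ g)).card * (p₀ * (1 - p₀)) ^ (R.card + 1) * J := by ring
  rw [hpow] at h
  simp only [hY, hU, hqY, hfdef] at h
  exact h

/-- **Local explicit (S5) margin (cylinder witnesses)**: at a compatible injective rank, from a relay `a ∈ T`, a pair `e ∈ E` missing `T_{<a}`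
and cylinder witnesses `(R₁, η₁)` (an `F(V 𝒞_a)`-jump `≥ J` at `e`) and `(R₂, η₂)` (`e` pivotal for the floor's event) inside the pairs of `E`
missing `T_{<a}` (`R₁ ∪ R₂ ⊆ R`): **`p₀^{N_{<a}} · (p₀(1−p₀))^{|R| + 1} · J ≤ s5dMargin w T r [] o v F`**.
[cite: KozmaNitzan2024, Conj. 4 (p. 32)] [cite: Harris1960, Lemma 4.1 (p. 16)] -/
theorem s5dMargin_nil_ge_explicit_cyl (w : Sym2 (Fin n) → unitInterval) (E : Finset (Sym2 (Fin n))) (p₀ : ℝ) (hp0 : 0 < p₀)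
    (hE0 : ∀ f, f ∉ E → (w f : ℝ) = 0) (hE1 : ∀ f ∈ E, p₀ ≤ (w f : ℝ) ∧ (w f : ℝ) ≤ 1 - p₀)
    (T : Finset (Fin n)) (r : Fin n → ℕ) (hr : Set.InjOn r ↑T) (o v : Fin n) (hoT : o ∉ T) (hvT : v ∉ T) (hov : o ≠ v)
    (F : Set (Fin n) → ℝ) (hF : ∀ S S' : Set (Fin n), S ⊆ S' → F S ≤ F S') (hF0 : ∀ S : Set (Fin n), 0 ≤ F S)
    (hcompat : ∀ a ∈ T, ∀ a' ∈ T, r a < r a' →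
      ∫ ω, F (openCluster ω a) ∂(prodBernoulli w) ≤ ∫ ω, F (openCluster ω a') ∂(prodBernoulli w))
    (a : Fin n) (ha : a ∈ T)
    (e : Sym2 (Fin n)) (heE : e ∈ E) (heY : ∀ y ∈ (↑(T.filter (fun b => r b < r a)) : Set (Fin n)), y ∉ e)
    (R R₁ R₂ : Finset (Sym2 (Fin n)))
    (hR : ∀ g ∈ R, g ∈ E ∧ g ≠ e ∧ ∀ y ∈ (↑(T.filter (fun b => r b < r a)) : Set (Fin n)), y ∉ g)
    (hR₁ : R₁ ⊆ R) (hR₂ : R₂ ⊆ R)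
    (η₁ η₂ : Set (Sym2 (Fin n))) (J : ℝ) (hJ : 0 ≤ J)
    (hc₁ : ∀ ω : Set (Sym2 (Fin n)), ω ⊆ ↑(E.filter (fun g => ∀ y ∈ (↑(T.filter (fun b => r b < r a)) : Set (Fin n)), y ∉ g)) →
      (∀ g ∈ R₁, (g ∈ ω ↔ g ∈ η₁)) →
      J ≤ F {c | c = a ∨ ∃ e' ∈ openEdgeCluster (insert e ω) a, c ∈ e'} - F {c | c = a ∨ ∃ e' ∈ openEdgeCluster (ω \ {e}) a, c ∈ e'})
    (hc₂ : ∀ ω : Set (Sym2 (Fin n)), ω ⊆ ↑(E.filter (fun g => ∀ y ∈ (↑(T.filter (fun b => r b < r a)) : Set (Fin n)), y ∉ g)) →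
      (∀ g ∈ R₂, (g ∈ ω ↔ g ∈ η₂)) →
      insert e ω ∈ ((⋃ t ∈ (insert a (T.filter (fun b => r a < r b) ∪ ([] : List (Fin n)).toFinset)), openConn o t) ∪ openConn o v :
          Set (BondConfig (Fin n))) ∧
        ω \ {e} ∉ ((⋃ t ∈ (insert a (T.filter (fun b => r a < r b) ∪ ([] : List (Fin n)).toFinset)), openConn o t) ∪ openConn o v :
          Set (BondConfig (Fin n)))) :
    p₀ ^ (E.filter (fun g : Sym2 (Fin n) => ∃ y ∈ (↑(T.filter (fun b => r b < r a)) : Set (Fin n)), y ∈ g)).card *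
        (p₀ * (1 - p₀)) ^ (R.card + 1) * J ≤
      s5dMargin w T r [] o v F := by
  have hw1r : ∀ g, (w g : ℝ) < 1 := by
    intro g
    by_cases hg : g ∈ E
    · linarith [(hE1 g hg).2]
    · rw [hE0 g hg]; norm_num
  have hw : ∀ g, w g < 1 := fun g => by
    have h := hw1r g
    exact Subtype.coe_lt_coe.1 (by simpa using h)
  have hiso := floor_iso_ge_explicit_cyl w E p₀ hp0 hE0 hE1 o v T r ([] : List (Fin n)) a F hF hF0 e heE heY R R₁ R₂ hR hR₁ hR₂ η₁ η₂ J hJ hc₁ hc₂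
  have hnn := fun a' (ha' : a' ∈ T) => isolatedFloor_term_nonneg w o v T r F hF hF0 hcompat a' ha'
  have hsum := Finset.single_le_sum (fun a' ha' => add_nonneg (hnn a' ha').1 (hnn a' ha').2) ha
  have hfloor := s5dMargin_ge_sum_rankGain_add_isolatedFloor_of_lt_one_of_compat w hw o v hov T r F hF hF0 hr hcompat hoT hvT
  linarith [(hnn a ha).1]

end CSH

end Summit.CriticalPhenomena.PercolationContinuityZ3.Theorems

end
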